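import Summits.NavierStokesRegularity.NavierStokesRegularity.Theorems.ExtremiserTransienceMemberSelectionLimitDichotomy
import HarnessLib

/-!
# LINE g7-δ «member selection», T1: THE BACK END ASSEMBLED — selection data ⇒ the conclusion of `CoherentSelection`

Crux `NearExtremalTransiencePerFlow` (stmt-NavierStokesRegularity-26567), line δ `member_selection`, stub T1
`stub_coherentSelection : CoherentSelection` (texts of record in `…Theorems.ExtremiserTransienceMemberSelection[Defs]`).
This file pins down WHAT THE FRONT END (cell-wise Cauchy–Schwarz selection + nesting, with the landed bricks
`share_le_of_taylor`, `exists_gridCollar_integral_le`, `exists_efficient_good_piece`, the GUARD and `budgetRetention`) MUST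
DELIVER, and proves that it suffices: given a near-extremal family `v` (`NearExtremalFamily v Λ Θ ε`), CENTRES `y n`, an
EXHAUSTION `D k ⊇ B(0, ρ k)` by bounded measurable sets (`ρ k → ∞`, deficits `δ k → 0`) on which the translates
`z ↦ v n (y n + z)` are EVENTUALLY `(κ⋆ − δ k)`-efficient at height `1`, and a RETAINED BUDGET `c > 0` on the unit ball
(eventually `c ≤ ∫_{B(0,1)} (‖curl‖² + |D curl|²_F)` for the translates), there are a subsequence `φ` and a pointwise limit
`W₀` of the translates with `IsExtremalSlice W₀ ∨ IsTubeSlice W₀` — i.e. exactly the conclusion of `CoherentSelection`.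
Proof: `exists_limit_of_nearExtremalFamily` (C^∞_loc limit + EXACTNESS of the three restricted budgets), the efficiency and
the retained budget pass to `W₀` (`le_of_tendsto_of_tendsto'`), the retained budget makes `curl W₀ ≢ 0`, and
`isExtremalSlice_or_isTubeSlice_of_exhaustion` concludes.

* `coherentSelection_of_selectionData` — the back end.

Pure analysis; nothing here is a statement about Navier–Stokes.  What remains of T1 is the FRONT END (selection data from
`NearExtremalFamily`, whose analytic heart is the a-priori bound (a) for collared cores).  26567, T1, T3, NS regularity OPEN.
No summit is proved by a line.
-/

noncomputable section

open scoped Topology InnerProductSpace RealInnerProductSpace ENNReal ContDiff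
open MeasureTheory Filter Set Metric
open Literature.Analysis.FluidPDE
open Summit.NavierStokesRegularity.NavierStokesRegularity.Theorems.DepletionLadder.KStar.HalfSpace

namespace Summit.NavierStokesRegularity.NavierStokesRegularity.Theorems.NearExtremalTransiencePerFlow.MemberSelection

set_option linter.dupNamespace false

/-- **T1 back end: selection data ⇒ the conclusion of `CoherentSelection`.** [folklore] -/
theorem coherentSelection_of_selectionData
    {v : ℕ → EuclideanSpace ℝ (Fin 3) → EuclideanSpace ℝ (Fin 3)} {Λ : ℕ → ℝ} {Θ : ℝ} {ε : ℕ → ℝ}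
    (hv : NearExtremalFamily v Λ Θ ε) (y : ℕ → EuclideanSpace ℝ (Fin 3))
    {D : ℕ → Set (EuclideanSpace ℝ (Fin 3))} {ρ δ : ℕ → ℝ} (hρ : Tendsto ρ atTop atTop) (hδ : Tendsto δ atTop (𝓝 0))
    (hD : ∀ k, MeasurableSet (D k) ∧ Metric.ball 0 (ρ k) ⊆ D k ∧ Bornology.IsBounded (D k))
    (heff : ∀ k, ∀ᶠ n in atTop,
      (kStar - δ k) * 1 * Real.sqrt (∫ x in D k, ‖curl (fun z => v n (y n + z)) x‖ ^ 2) *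
          Real.sqrt (∫ x in D k, frobeniusNormSq (fderiv ℝ (curl (fun z => v n (y n + z))) x)) ≤
        |∫ x in D k, ⟪curl (fun z => v n (y n + z)) x,
            fderiv ℝ (fun z => v n (y n + z)) x (curl (fun z => v n (y n + z)) x)⟫_ℝ|)
    {c : ℝ} (hc : 0 < c)
    (hret : ∀ᶠ n in atTop, c ≤ ∫ x in Metric.ball (0 : EuclideanSpace ℝ (Fin 3)) 1,
      (‖curl (fun z => v n (y n + z)) x‖ ^ 2 + frobeniusNormSq (fderiv ℝ (curl (fun z => v n (y n + z))) x))) :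
    ∃ (φ : ℕ → ℕ) (W₀ : EuclideanSpace ℝ (Fin 3) → EuclideanSpace ℝ (Fin 3)),
      StrictMono φ ∧ (∀ z, Tendsto (fun n => v (φ n) (y (φ n) + z)) atTop (𝓝 (W₀ z))) ∧
      (IsExtremalSlice W₀ ∨ IsTubeSlice W₀) := by
  obtain ⟨φ, W₀, hφ, hW, hWdiv, hW1, hWb, hpt, -, -, -, -, hexact⟩ := exists_limit_of_nearExtremalFamily hv y
  refine ⟨φ, W₀, hφ, hpt, ?_⟩
  have hφt : Tendsto φ atTop atTop := hφ.tendsto_atTop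
  obtain ⟨hsm, -, -, -, -⟩ := hv
  -- gradient bound of the limit
  have hWB : ∀ x, ‖fderiv ℝ W₀ x‖ ≤ Λ 1 := fun x => by
    rw [norm_fderiv_eq_norm_iteratedFDeriv_one]; exact hWb 1 x
  -- continuity of `curl`, `D curl` for the translates and for `W₀`
  have hW1c : ContDiff ℝ 1 W₀ := contDiff_infty.1 hW 1
  have hW2c : ContDiff ℝ 2 W₀ := contDiff_infty.1 hW 2
  have hcurlW : Continuous (curl W₀) := (contDiff_curl (n := 0) (by exact_mod_cast hW1c)).continuous
  have hDcurlW : Continuous (fderiv ℝ (curl W₀)) :=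
    (contDiff_curl (n := 1) (by exact_mod_cast hW2c)).continuous_fderiv one_ne_zero
  have hfs : ∀ n, ContDiff ℝ ∞ (fun z => v n (y n + z)) := fun n =>
    (hsm n).comp (contDiff_const.add contDiff_id)
  have hcurlf : ∀ n, Continuous (curl (fun z => v n (y n + z))) := fun n =>
    (contDiff_curl (n := 0) (by exact_mod_cast (contDiff_infty.1 (hfs n) 1))).continuous
  have hDcurlf : ∀ n, Continuous (fderiv ℝ (curl (fun z => v n (y n + z)))) := fun n =>
    (contDiff_curl (n := 1) (by exact_mod_cast (contDiff_infty.1 (hfs n) 2))).continuous_fderiv one_ne_zero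
  -- integrability of continuous densities on bounded sets
  have hInt : ∀ {g : EuclideanSpace ℝ (Fin 3) → ℝ}, Continuous g → ∀ {S : Set (EuclideanSpace ℝ (Fin 3))},
      Bornology.IsBounded S → IntegrableOn g S volume := fun hg S hS =>
    (hg.continuousOn.integrableOn_compact hS.isCompact_closure).mono_set subset_closure
  have hfrob_cont : ∀ {w : EuclideanSpace ℝ (Fin 3) → EuclideanSpace ℝ (Fin 3)}, Continuous (fderiv ℝ (curl w)) →
      Continuous fun x => frobeniusNormSq (fderiv ℝ (curl w) x) := fun hw => continuous_frobeniusNormSq.comp hw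
  -- (1) efficiency on the exhaustion passes to the limit
  have hDW : ∀ k, MeasurableSet (D k) ∧ Metric.ball 0 (ρ k) ⊆ D k ∧ Bornology.IsBounded (D k) ∧
      (kStar - δ k) * 1 * Real.sqrt (∫ x in D k, ‖curl W₀ x‖ ^ 2) *
          Real.sqrt (∫ x in D k, frobeniusNormSq (fderiv ℝ (curl W₀) x)) ≤
        |∫ x in D k, ⟪curl W₀ x, fderiv ℝ W₀ x (curl W₀ x)⟫_ℝ| := by
    intro k
    obtain ⟨hDm, hDball, hDbdd⟩ := hD k
    obtain ⟨tZ, tP, tJ⟩ := hexact (D k) hDm hDbdd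
    refine ⟨hDm, hDball, hDbdd, ?_⟩
    have tL := ((tendsto_const_nhds (x := (kStar - δ k) * 1)).mul tZ.sqrt).mul tP.sqrt
    have tR := tJ.abs
    exact le_of_tendsto_of_tendsto tL tR (hφt.eventually (heff k))
  -- (2) the retained budget passes to the limit, so `curl W₀ ≢ 0`
  have hbdd1 : Bornology.IsBounded (Metric.ball (0 : EuclideanSpace ℝ (Fin 3)) 1) := isBounded_ball
  obtain ⟨tZ1, tP1, -⟩ := hexact (Metric.ball 0 1) measurableSet_ball hbdd1
  have tsum : Tendsto (fun n => ∫ x in Metric.ball (0 : EuclideanSpace ℝ (Fin 3)) 1,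
      (‖curl (fun z => v (φ n) (y (φ n) + z)) x‖ ^ 2 +
        frobeniusNormSq (fderiv ℝ (curl (fun z => v (φ n) (y (φ n) + z))) x))) atTop
      (𝓝 ((∫ x in Metric.ball (0 : EuclideanSpace ℝ (Fin 3)) 1, ‖curl W₀ x‖ ^ 2) +
        ∫ x in Metric.ball (0 : EuclideanSpace ℝ (Fin 3)) 1, frobeniusNormSq (fderiv ℝ (curl W₀) x))) := by
    refine (tZ1.add tP1).congr fun n => ?_
    exact (integral_add (hInt ((hcurlf (φ n)).norm.pow 2) hbdd1) (hInt (hfrob_cont (hDcurlf (φ n))) hbdd1)).symm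
  have hcW : c ≤ (∫ x in Metric.ball (0 : EuclideanSpace ℝ (Fin 3)) 1, ‖curl W₀ x‖ ^ 2) +
      ∫ x in Metric.ball (0 : EuclideanSpace ℝ (Fin 3)) 1, frobeniusNormSq (fderiv ℝ (curl W₀) x) :=
    ge_of_tendsto tsum (hφt.eventually hret)
  have hnt : ∃ x₀, curl W₀ x₀ ≠ 0 := by
    by_contra hall
    push Not at hall
    have hc0 : curl W₀ = fun _ => 0 := funext hall
    have h1 : (∫ x in Metric.ball (0 : EuclideanSpace ℝ (Fin 3)) 1, ‖curl W₀ x‖ ^ 2) = 0 := by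
      simp [hc0]
    have h2 : (∫ x in Metric.ball (0 : EuclideanSpace ℝ (Fin 3)) 1, frobeniusNormSq (fderiv ℝ (curl W₀) x)) = 0 := by
      have hfd : ∀ x, fderiv ℝ (curl W₀) x = 0 := fun x => by rw [hc0]; exact fderiv_const_apply 0
      simp only [hfd]
      unfold frobeniusNormSq
      simp
    rw [h1, h2, add_zero] at hcW
    exact absurd hcW (not_le.2 hc)
  -- (3) the dichotomy
  exact isExtremalSlice_or_isTubeSlice_of_exhaustion hW hWdiv one_pos hW1 hWB hnt hρ hδ hDW

end Summit.NavierStokesRegularity.NavierStokesRegularity.Theorems.NearExtremalTransiencePerFlow.MemberSelection
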